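import Summits.HodgeConjecture.HodgeConjecture.Theorems.Ring2AbelianAllFrame
import Summits.HodgeConjecture.HodgeConjecture.Theorems.Ring2AbelianAllLefschetzPencils
import HarnessLib

/-!
# Ring 2 · sub-cell AbelianAll, André axis, part III — the JUNCTION of the two André seats: andre-2's nodes
# (parts I/II) ≡ andre-1's nodes (`Ring2AbelianAllLefschetzPencils`), and the Lefschetz-`B` rows of part II with
# the hypothesis SHAPE `Milne2020Prop1[]` DISCHARGED BY NAME by andre-1's Literature fact
# `Abdulali1994.Abdulali1994_invariantCycles_of_lefschetzStandard` (Abdulali 1994 p. 1122 = Milne 2020 Prop. 1)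

HONEST FRAMING (page 1, verbatim): **research route, not a corollary; conditional on HC_CM plus one named
minimal statement.** Cell line: research route conditional on HC_CM; not a corollary; Q11.4-sentence-2
already refuted in dim ≥ 3. Nothing in this file proves a case of the Hodge conjecture. `HC_CM` =
`Theses.RankFourFaces.CMAbelianHodge` (a BINDER, never cited), `HC_AV` = `Theses.PadicSemiregularLift.HodgeAbelianVarieties`,
item `Theses.RankFourFaces.CMToAbelian` (stmt-16267) OPEN and not closed here. Seat `pub-hodge-ring2-ab-andre-2`,
gen 1 (written after andre-1's `Theorems/Ring2AbelianAllLefschetzPencils.lean` and the LEAD's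
`Theorems/Ring2AbelianAllFrame.lean` landed; the two André seats typed the same candidates in the same hour —
this file makes "count once" a kernel statement).

## Content

* §R RECONCILIATION (all `Iff`, no hypothesis): (5∀) `LefschetzBCompactPencils ↔ CompactAbelianPencilLefschetz`
  (`Iff.rfl`); (5) `LefschetzBCMPointedPencils ↔ CMPointedPencilLefschetz` (CM locus non-empty ↔ a CM chart: the
  dimension clause of `Deligne1982.cmLocus` is automatic on a pencil); (4) `CMAnchoredTransport ↔ CMFibreTransport`
  (binder order and `t ∈ cmLocus f d` versus an explicit CM chart). With the Frame's `cmPointedPencilVHC_iff_deform`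
  ((3) ↔ deform VI) every André-axis node now has ONE statement up to a kernel `Iff`.
* §M the rows of part II §D with `hM : Milne2020Prop1[]` INSTANTIATED by the named fact
  `h₈ : Abdulali1994_invariantCycles_of_lefschetzStandard` (andre-1, `Literature/AlgebraicGeometry/Abdulali1994/
  LefschetzStandardTransport.lean`; its body is the shape, symbol for symbol): (5) ⟹ (3), `HC_CM ∧ (5) ⟹ HC_AV`
  (mod `h₈`, Lemme 6.3.1), the KIND-1 row (5∀) ⟹ `HC_AV` with NO `HC_CM` (mod `h₈`, Lemmes 6.3.1–6.3.3; routed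
  THROUGH andre-1's `HC_AV_of_abdulali_of_andre1996_of_compactAbelianPencilLefschetz`, not re-proved), and the chain.
* §F the Frame grammar (LEAD, `Ring2AbelianAllFrame`) for the Lefschetz nodes: `ClosesWithCM` for (5) and (5∀)
  (mod `h₈`, `h₂₁`), `CMIdle` for (5∀) (mod `h₈`, `h₂₁`, `h₂₂`). Deliberately NOT stated: `OnPathAV` for (5)/(5∀)
  — `B` of the total space is NOT known to follow from `HC_AV` (only from the Hodge conjecture for `𝒳 × 𝒳`, part II
  `lefschetzBCompactPencils_of_hodgeConjecture` modulo Kleiman's fact); so (5), (5∀) are SUFFICIENT complements of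
  `HC_CM`, not exact ones, in contrast with (3), (4), (T∃) (parts I/II, exact modulo Lemme 6.3.1).
* Referee items served (REFEREE-AB R-04): F-ab-13 — (T∃) `CMAnchoredPencilTransport` is weaker than (4) ONLY
  modulo Lemme 6.3.1 (the existential of 6.3.1 is part of its statement: `cmAnchoredPencilTransport_of_andre1996_of_…`
  carries `h₂₁`), and (T∃) holds trivially at a CM abelian variety (a constant pencil qualifies) — which is why it
  is `HC_CM`-complementary and silent about CM varieties; recorded here in prose, no kernel object needed. F-ab-11 —
  `h₈` is stated by andre-1 for `Motives.IsCompactAbelianPencil` (section + abelian fibres, no group law); the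
  passage to an abelian SCHEME (Milne's carrier; `θ_n` in his proof) is Mumford, GIT Thm. 6.14, cited in its
  docstring's faithfulness notes — a print input of every `h₈`-row below.

References: Abdulali1994FamiliesAV (p. 1122; Conj. 5.3, Thm 5.5, Thm 6.1); Milne2020HodgeClassesAV (Prop. 1, Thm. 4);
Andre1996Motifs (Lemme 6.3.1, Remarque 2, pp. 31–33); MumfordGIT (Thm. 6.14); Kleiman1968AlgebraicCycles (§2).
-/

noncomputable section

set_option linter.dupNamespace false

namespace Summit.HodgeConjecture.HodgeConjecture.Ring2.AbelianAll

open CategoryTheory AlgebraicGeometry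
open Literature.AlgebraicGeometry Literature.AlgebraicGeometry.Motives
open Literature.AlgebraicGeometry.HodgeTheory
open Literature.AlgebraicGeometry.Milne1999 (IsOfCMType)
open Literature.AlgebraicGeometry.Abdulali1994 (InvariantCyclesHoldFor Abdulali1994_invariantCycles_of_lefschetzStandard)
open Literature.AlgebraicGeometry.Andre1996 (andre1996_cmAnchoredPencil
  andre1996_cmHodgeClasses_algebraicallyAnchoredPencils)
open Literature.AlgebraicGeometry.Deligne1982 (cmLocus)
open Summit.HodgeConjecture.HodgeConjecture
open Summit.HodgeConjecture.HodgeConjecture.Theses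
open Summit.HodgeConjecture.HodgeConjecture.Ring2.Deform (CompactAbelianPencilVHC)

/-! ## §R Reconciliation: one statement per node -/

/-- (5∀): andre-2's `LefschetzBCompactPencils` and andre-1's `CompactAbelianPencilLefschetz` are the same statement
(definitionally). [folklore] -/
theorem lefschetzBCompactPencils_iff_compactAbelianPencilLefschetz :
    LefschetzBCompactPencils ↔ CompactAbelianPencilLefschetz :=
  Iff.rfl

/-- (5): andre-2's `LefschetzBCMPointedPencils` (CM locus `Deligne1982.cmLocus f d` non-empty) and andre-1's
`CMPointedPencilLefschetz` (a CM chart `A₀.X ≅ 𝒳_t`) are equivalent: on a compact pencil of relative dimension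
`d` a CM chart has `dim A₀ = d` automatically (`mem_cmLocus_of_compactPencil`). [folklore] -/
theorem lefschetzBCMPointedPencils_iff_cmPointedPencilLefschetz :
    LefschetzBCMPointedPencils ↔ CMPointedPencilLefschetz := by
  constructor
  · rintro h d 𝒳 S f hf ⟨t, A₀, ⟨e⟩, hA₀⟩ η
    exact h f hf ⟨t, mem_cmLocus_of_compactPencil hf e hA₀⟩ η
  · rintro h d 𝒳 S f hf ⟨t, A₀, ⟨e⟩, -, hA₀⟩ η
    exact h f hf ⟨t, A₀, ⟨e⟩, hA₀⟩ η

/-- (4): andre-2's `CMAnchoredTransport` (`t ∈ cmLocus f d`) and andre-1's `CMFibreTransport` (an explicit CM chart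
at `t`) are equivalent — the sub-cell's `B_min` on the André axis is ONE statement. [folklore] -/
theorem cmAnchoredTransport_iff_cmFibreTransport : CMAnchoredTransport ↔ CMFibreTransport := by
  constructor
  · rintro h d 𝒳 S f hf t A₀ ⟨e⟩ hA₀ p W hW h₀ s
    exact h f hf p W hW t (mem_cmLocus_of_compactPencil hf e hA₀) h₀ s
  · rintro h d 𝒳 S f hf p W hW t ⟨A₀, ⟨e⟩, -, hA₀⟩ h₀ s
    exact h f hf t A₀ ⟨e⟩ hA₀ p W hW h₀ s

/-- The deliverable of part I read on andre-1's node: `HC_CM → CMFibreTransport → HC_AV`, modulo Lemme 6.3.1.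
[cite: Andre1996Motifs, Lemme 6.3.1 (p. 31) and §6.3 a) (p. 33)] -/
theorem HC_AV_of_HC_CM_and_cmFibreTransport (h₂₁ : andre1996_cmAnchoredPencil) (hCM : RankFourFaces.CMAbelianHodge)
    (hB : CMFibreTransport) : PadicSemiregularLift.HodgeAbelianVarieties :=
  HC_AV_of_HC_CM_and_Bmin h₂₁ hCM (cmAnchoredTransport_iff_cmFibreTransport.2 hB)

/-! ## §M Part II §D with Milne's Prop. 1 supplied BY NAME (andre-1's fact `h₈`) -/

/-- **(5) ⟹ (3), modulo the named fact `h₈`** (Abdulali 1994 p. 1122 / Milne 2020 Prop. 1, typed by andre-1; its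
body is part II's shape `Milne2020Prop1[]` verbatim, so this is `cmPointedPencilVHC_of_milne_of_lefschetzBCMPointedPencils h₈`).
[cite: Abdulali1994FamiliesAV, p. 1122] [cite: Milne2020HodgeClassesAV, Prop. 1 (p. 7)] -/
theorem cmPointedPencilVHC_of_abdulali_of_lefschetzBCMPointedPencils
    (h₈ : Abdulali1994_invariantCycles_of_lefschetzStandard) (hB : LefschetzBCMPointedPencils) :
    CMPointedPencilVHC :=
  cmPointedPencilVHC_of_milne_of_lefschetzBCMPointedPencils h₈ hB

/-- **(5∀) ⟹ (2), modulo `h₈`** — routed through andre-1's `compactAbelianPencilVHC_of_abdulali_of_compactAbelianPencilLefschetz`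
and §R (count once). [cite: Milne2020HodgeClassesAV, Thm. 4 (p. 8)] -/
theorem compactAbelianPencilVHC_of_abdulali_of_lefschetzBCompactPencils
    (h₈ : Abdulali1994_invariantCycles_of_lefschetzStandard) (hB : LefschetzBCompactPencils) :
    CompactAbelianPencilVHC :=
  compactAbelianPencilVHC_of_abdulali_of_compactAbelianPencilLefschetz h₈
    (lefschetzBCompactPencils_iff_compactAbelianPencilLefschetz.1 hB)

/-- **The Lefschetz-flavoured deliverable with every input NAMED: `HC_CM → (5) → HC_AV`, modulo André's Lemme
6.3.1 (`h₂₁`) and Abdulali p. 1122 / Milne Prop. 1 (`h₈`), both theorems in print, both Literature facts, both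
binders.** The open content of (5) is `B` for the `(2·dim A + 1)`-dimensional total spaces of CM-anchored
compact abelian pencils (not `B` for abelian varieties: Lieberman). research route, not a corollary; conditional
on HC_CM plus one named minimal statement. [cite: Andre1996Motifs, Lemme 6.3.1 (p. 31) and Remarque 2 (p. 33)]
[cite: Abdulali1994FamiliesAV, p. 1122] [cite: Milne2020HodgeClassesAV, Prop. 1 (p. 7)] -/
theorem HC_AV_of_HC_CM_of_abdulali_of_lefschetzBCMPointedPencils (h₂₁ : andre1996_cmAnchoredPencil)
    (h₈ : Abdulali1994_invariantCycles_of_lefschetzStandard) (hCM : RankFourFaces.CMAbelianHodge)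
    (hB : LefschetzBCMPointedPencils) : PadicSemiregularLift.HodgeAbelianVarieties :=
  HC_AV_of_HC_CM_of_milne_of_lefschetzBCMPointedPencils h₂₁ h₈ hCM hB

/-- **KIND-1 witness with named inputs**: granted `h₈`, Lemme 6.3.1 and Lemmes 6.3.2–6.3.3, (5∀) gives `HC_AV` with
NO `HC_CM` — André's Remarque 2 / Milne's Thm. 4 on compact pencils (andre-1's
`HC_AV_of_abdulali_of_andre1996_of_compactAbelianPencilLefschetz`, through §R).
[cite: Andre1996Motifs, Remarque 2 (p. 33)] [cite: Milne2020HodgeClassesAV, Thm. 4 (p. 8)] -/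
theorem HC_AV_of_andre1996_of_abdulali_of_lefschetzBCompactPencils (h₂₁ : andre1996_cmAnchoredPencil)
    (h₂₂ : andre1996_cmHodgeClasses_algebraicallyAnchoredPencils)
    (h₈ : Abdulali1994_invariantCycles_of_lefschetzStandard) (hB : LefschetzBCompactPencils) :
    PadicSemiregularLift.HodgeAbelianVarieties :=
  HC_AV_of_abdulali_of_andre1996_of_compactAbelianPencilLefschetz h₈ h₂₁ h₂₂
    (lefschetzBCompactPencils_iff_compactAbelianPencilLefschetz.1 hB)

/-- **The chain of parts I–II with `hM := h₈`** (every arrow a kernel theorem; named inputs displayed):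
(5∀) ⟹ (5) ⟹ (3) ⟹ (4) ⟹ (T∃) and (L∀) ⟹ (L) ⟹ (4). [cite: Andre1996Motifs, §6.3 (pp. 31–33)]
[cite: Abdulali1994FamiliesAV, p. 1122] -/
theorem chain_of_abdulali (h₈ : Abdulali1994_invariantCycles_of_lefschetzStandard)
    (h₂₁ : andre1996_cmAnchoredPencil) :
    (LefschetzBCompactPencils → LefschetzBCMPointedPencils) ∧ (LefschetzBCMPointedPencils → CMPointedPencilVHC) ∧
      (CMPointedPencilVHC → CMAnchoredTransport) ∧ (CMAnchoredTransport → CMAnchoredPencilTransport) ∧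
      (AlgebraicFixedPart → CMFibreAlgebraicLift) ∧ (CMFibreAlgebraicLift → CMAnchoredTransport) :=
  chain h₈ h₂₁

/-! ## §F The Frame grammar for the Lefschetz nodes -/

/-- (5) is a SUFFICIENT complement of `HC_CM` (`Frame.ClosesWithCM`), modulo `h₈` and Lemme 6.3.1. NOT claimed:
`OnPathAV LefschetzBCMPointedPencils` — `B` of a total space is not known to follow from `HC_AV`.
[cite: Abdulali1994FamiliesAV, p. 1122] [cite: Andre1996Motifs, Lemme 6.3.1 (p. 31)] -/
theorem closesWithCM_lefschetzBCMPointedPencils_of_abdulali_of_andre1996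
    (h₈ : Abdulali1994_invariantCycles_of_lefschetzStandard) (h₂₁ : andre1996_cmAnchoredPencil) :
    ClosesWithCM LefschetzBCMPointedPencils :=
  fun hCM hB ↦ HC_AV_of_HC_CM_of_abdulali_of_lefschetzBCMPointedPencils h₂₁ h₈ hCM hB

/-- (5∀) is a sufficient complement of `HC_CM` (by antitonicity from (5)). [folklore] -/
theorem closesWithCM_lefschetzBCompactPencils_of_abdulali_of_andre1996
    (h₈ : Abdulali1994_invariantCycles_of_lefschetzStandard) (h₂₁ : andre1996_cmAnchoredPencil) :
    ClosesWithCM LefschetzBCompactPencils :=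
  closesWithCM_antitone lefschetzBCMPointedPencils_of_lefschetzBCompactPencils
    (closesWithCM_lefschetzBCMPointedPencils_of_abdulali_of_andre1996 h₈ h₂₁)

/-- **(5∀) makes `HC_CM` IDLE (`Frame.CMIdle`)**, modulo `h₈` and Lemmes 6.3.1–6.3.3: the honest-column verdict
"KIND 1" for André's Remarque 2 node, as a kernel predicate. [cite: Andre1996Motifs, Remarque 2 (p. 33)]
[cite: Milne2020HodgeClassesAV, Thm. 4 (p. 8)] -/
theorem cmIdle_lefschetzBCompactPencils_of_abdulali_of_andre1996
    (h₈ : Abdulali1994_invariantCycles_of_lefschetzStandard) (h₂₁ : andre1996_cmAnchoredPencil)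
    (h₂₂ : andre1996_cmHodgeClasses_algebraicallyAnchoredPencils) : CMIdle LefschetzBCompactPencils :=
  fun hB ↦ HC_AV_of_andre1996_of_abdulali_of_lefschetzBCompactPencils h₂₁ h₂₂ h₈ hB

/-- `CMToAbelian` from (5), modulo `h₈` and Lemme 6.3.1 (a typed conditional TOWARD the open item 16267; nothing
closes it). [cite: Andre1996Motifs, Lemme 6.3.1 (p. 31)] [cite: Abdulali1994FamiliesAV, p. 1122] -/
theorem cmToAbelian_of_abdulali_of_andre1996_of_lefschetzBCMPointedPencils
    (h₈ : Abdulali1994_invariantCycles_of_lefschetzStandard) (h₂₁ : andre1996_cmAnchoredPencil)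
    (hB : LefschetzBCMPointedPencils) : RankFourFaces.CMToAbelian :=
  cmToAbelian_of_closesWithCM (closesWithCM_lefschetzBCMPointedPencils_of_abdulali_of_andre1996 h₈ h₂₁) hB

end Summit.HodgeConjecture.HodgeConjecture.Ring2.AbelianAll

end
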